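import Mathlib
import Summits.ValiantsHypothesis.ValiantsHypothesis.Theorems.LacunarySymmetroidMatrixDescartesCensusWindowFourPocketSecant
import Summits.ValiantsHypothesis.ValiantsHypothesis.Theorems.LacunarySymmetroidMatrixDescartesCensusWindowFourPocketTable

/-!
# `MatrixDescartes` census — WINDOW-4 POCKET SECANT ROWS, exponent-TABLE form

HONEST FRAMING.  Object-search cell `pub-symmetroid`, door-A target `DoorA26 := PosRootLawAt 2 6 19`
(stmt-ValiantsHypothesis-19979; OPEN, typed, never asserted).  Necessary-condition rows about the four-term WINDOWS of HYPOTHETICAL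
Descartes-sharp fewnomials; nothing here bounds any census count, kills any cell or bears on `MatrixDescartes`
(stmt-ValiantsHypothesis-18050) / `VP ≠ VNP`.

Packaging only (companion of `…CensusWindowFourPocketTable`, same currency: exponent table `E`, window `r<s<u<v<n` with gaps `U₁,V,W`
and absolute twist multipliers `M_t`, split logarithms `Real.log |c t| + Real.log M_t`).  The SECANT rows of
`…CensusWindowFourPocketSecant` (`fourNomial_pocket_secant_lower/upper_of_three_le_countP`) with two table parameters
`tlo = tln/tld`, `thi = thn/thd` (naturals `Alo, Blo, Ahi, Bhi` as in the transfer rows), real slab ends `ℓlo, ℓhi`, an intercept `φlo`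
and a rational slope `sn/sd ≥ 0`, conclusion scaled by `sd`:

* `window_four_pocket_secant_lower_of_table`: `thi ≤ tlo ≤ t*`, `Λ2(tlo) ≤ ℓlo`, `Λ2(thi) ≤ ℓhi`, `φlo ≤ Λ1(tlo)`,
  `sn(ℓhi − ℓlo) ≤ sd(Λ1(thi) − φlo)`, `ℓlo ≤ σ2 ≤ ℓhi` ⇒ `sd·φlo − sn·ℓlo ≤ sd·σ1 − sn·σ2`;
* `window_four_pocket_secant_upper_of_table`: the mirror on the upper branch ⇒ `sd·φlo − sn·ℓlo ≤ sd·σ2 − sn·σ1`.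

These are the `xt-sec` rows of the exact-tube instrument (engine-2 `hybrid38` / `exacttubet`) as a generated kill file instantiates them.

[folklore] `Real.log` of products and quotients; elementary.  Tool of the `pub-symmetroid` exact-tube typing path (engine-2 g35).
-/

-- `Summit.ValiantsHypothesis.ValiantsHypothesis.…` repeats a component by the D-0017 layout
-- (single-conjunct summit), which the `dupNamespace` linter flags; the name is mandated.
set_option linter.dupNamespace false

namespace Summit.ValiantsHypothesis.ValiantsHypothesis.Theorems.LacunarySymmetroidMatrixDescartes.Census

open Polynomial Finset Set
open scoped BigOperators Polynomial

/-- **Secant row on the lower branch, table form.**  Slab ends certified by two table parameters `thi = thn/thd ≤ tlo = tln/tld ≤ t*`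
(`Λ2(tlo) ≤ ℓlo`, `Λ2(thi) ≤ ℓhi`), an intercept `φlo ≤ Λ1(tlo)`, a rational slope `sn/sd ≥ 0` with `sn·(ℓhi − ℓlo) ≤ sd·(Λ1(thi) − φlo)`, and the
slab `ℓlo ≤ σ2 ≤ ℓhi` give `sd·φlo − sn·ℓlo ≤ sd·σ1 − sn·σ2` (split logarithms). [folklore] -/
theorem window_four_pocket_secant_lower_of_table {n : ℕ} {e : ℕ → ℕ} {c : ℕ → ℝ} (he : ∀ i j, i < j → j < n → e i < e j)
    (hZ : n ≤ (∑ t ∈ range n, C (c t) * X ^ (e t) : ℝ[X]).roots.countP (fun x => 0 < x) + 1)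
    (E : List ℕ) (hE : ∀ t, t < n → e t = E.getD t 0)
    {r s u v : ℕ} (hrs : r < s) (hsu : s < u) (huv : u < v) (hvn : v < n) (U₁ V W : ℕ)
    (hU₁ : E.getD r 0 + U₁ = E.getD s 0) (hV : E.getD s 0 + V = E.getD u 0) (hW : E.getD u 0 + W = E.getD v 0)
    (Mr Ms Mu Mv : ℝ)
    (hMr : |∏ w ∈ (range n).filter (fun w => ¬(w = r ∨ w = s ∨ w = u ∨ w = v)), (((E.getD r 0 : ℕ) : ℝ) - (E.getD w 0 : ℕ))| = Mr)
    (hMs : |∏ w ∈ (range n).filter (fun w => ¬(w = r ∨ w = s ∨ w = u ∨ w = v)), (((E.getD s 0 : ℕ) : ℝ) - (E.getD w 0 : ℕ))| = Ms)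
    (hMu : |∏ w ∈ (range n).filter (fun w => ¬(w = r ∨ w = s ∨ w = u ∨ w = v)), (((E.getD u 0 : ℕ) : ℝ) - (E.getD w 0 : ℕ))| = Mu)
    (hMv : |∏ w ∈ (range n).filter (fun w => ¬(w = r ∨ w = s ∨ w = u ∨ w = v)), (((E.getD v 0 : ℕ) : ℝ) - (E.getD w 0 : ℕ))| = Mv)
    (tln tld Alo Blo thn thd Ahi Bhi : ℕ) (htln : 0 < tln) (htld : 0 < tld) (hthn : 0 < thn) (hthd : 0 < thd)
    (hAlo : (U₁ + V) * tld + W * tln = Alo) (hBlo : U₁ * tld + (V + W) * tln = Blo)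
    (hAhi : (U₁ + V) * thd + W * thn = Ahi) (hBhi : U₁ * thd + (V + W) * thn = Bhi)
    (hth : thn * tld ≤ tln * thd) (htlo : W * (V + W) * tln ≤ U₁ * (U₁ + V) * tld)
    (sn sd : ℕ) (hsd : 0 < sd) {ℓlo ℓhi φlo : ℝ}
    (hclo : ((V : ℝ) + W) * Real.log (Blo : ℝ) - (W : ℝ) * Real.log (Alo : ℝ) - (V : ℝ) * Real.log (tln : ℝ) - (V : ℝ) * Real.log (V : ℝ) ≤ ℓlo)
    (hchi : ((V : ℝ) + W) * Real.log (Bhi : ℝ) - (W : ℝ) * Real.log (Ahi : ℝ) - (V : ℝ) * Real.log (thn : ℝ) - (V : ℝ) * Real.log (V : ℝ) ≤ ℓhi)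
    (hφ : φlo ≤ ((U₁ : ℝ) + V) * Real.log (Alo : ℝ) - (U₁ : ℝ) * Real.log (Blo : ℝ) - (V : ℝ) * Real.log (tld : ℝ) - (V : ℝ) * Real.log (V : ℝ))
    (hslope : (sn : ℝ) * (ℓhi - ℓlo)
      ≤ (sd : ℝ) * ((((U₁ : ℝ) + V) * Real.log (Ahi : ℝ) - (U₁ : ℝ) * Real.log (Bhi : ℝ) - (V : ℝ) * Real.log (thd : ℝ)
          - (V : ℝ) * Real.log (V : ℝ)) - φlo))
    (hσlo : ℓlo ≤ ((V : ℝ) + W) * (Real.log |c u| + Real.log Mu) - (W : ℝ) * (Real.log |c s| + Real.log Ms)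
        - (V : ℝ) * (Real.log |c v| + Real.log Mv))
    (hσhi : ((V : ℝ) + W) * (Real.log |c u| + Real.log Mu) - (W : ℝ) * (Real.log |c s| + Real.log Ms)
        - (V : ℝ) * (Real.log |c v| + Real.log Mv) ≤ ℓhi) :
    (sd : ℝ) * φlo - (sn : ℝ) * ℓlo
      ≤ (sd : ℝ) * (((U₁ : ℝ) + V) * (Real.log |c s| + Real.log Ms) - (V : ℝ) * (Real.log |c r| + Real.log Mr)
          - (U₁ : ℝ) * (Real.log |c u| + Real.log Mu))
        - (sn : ℝ) * (((V : ℝ) + W) * (Real.log |c u| + Real.log Mu) - (W : ℝ) * (Real.log |c s| + Real.log Ms)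
          - (V : ℝ) * (Real.log |c v| + Real.log Mv)) := by
  obtain ⟨hU, hVp, hWp, ⟨h3, hA, hB, hC, hD⟩, er, es, eu, ev⟩ :=
    window_four_table_prelims he hZ E hE hrs hsu huv hvn U₁ V W hU₁ hV hW Mr Ms Mu Mv hMr hMs hMu hMv
  have hAlo0 : 0 < Alo := by rw [← hAlo]; positivity
  have hBlo0 : 0 < Blo := by rw [← hBlo]; positivity
  have hAhi0 : 0 < Ahi := by rw [← hAhi]; positivity
  have hBhi0 : 0 < Bhi := by rw [← hBhi]; positivity
  have htld' : (0 : ℝ) < tld := by exact_mod_cast htld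
  have hthd' : (0 : ℝ) < thd := by exact_mod_cast hthd
  have hsd' : (0 : ℝ) < sd := by exact_mod_cast hsd
  have eAlo : Real.log (((U₁ : ℝ) + V) + (W : ℝ) * ((tln : ℝ) / (tld : ℝ))) = Real.log (Alo : ℝ) - Real.log (tld : ℝ) := by
    have h := log_affine_ratio_of_nat (U₁ + V) W tln tld Alo htld hAlo hAlo0
    push_cast at h; exact h
  have eBlo : Real.log ((U₁ : ℝ) + ((V : ℝ) + W) * ((tln : ℝ) / (tld : ℝ))) = Real.log (Blo : ℝ) - Real.log (tld : ℝ) := by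
    have h := log_affine_ratio_of_nat U₁ (V + W) tln tld Blo htld hBlo hBlo0
    push_cast at h; exact h
  have etlo : Real.log ((tln : ℝ) / (tld : ℝ)) = Real.log (tln : ℝ) - Real.log (tld : ℝ) :=
    Real.log_div (by exact_mod_cast htln.ne') htld'.ne'
  have eAhi : Real.log (((U₁ : ℝ) + V) + (W : ℝ) * ((thn : ℝ) / (thd : ℝ))) = Real.log (Ahi : ℝ) - Real.log (thd : ℝ) := by
    have h := log_affine_ratio_of_nat (U₁ + V) W thn thd Ahi hthd hAhi hAhi0
    push_cast at h; exact h
  have eBhi : Real.log ((U₁ : ℝ) + ((V : ℝ) + W) * ((thn : ℝ) / (thd : ℝ))) = Real.log (Bhi : ℝ) - Real.log (thd : ℝ) := by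
    have h := log_affine_ratio_of_nat U₁ (V + W) thn thd Bhi hthd hBhi hBhi0
    push_cast at h; exact h
  have ethi : Real.log ((thn : ℝ) / (thd : ℝ)) = Real.log (thn : ℝ) - Real.log (thd : ℝ) :=
    Real.log_div (by exact_mod_cast hthn.ne') hthd'.ne'
  have hs : (0 : ℝ) ≤ (sn : ℝ) / (sd : ℝ) := by positivity
  have hthi : (0 : ℝ) < (thn : ℝ) / (thd : ℝ) := by positivity
  have hth' : (thn : ℝ) / (thd : ℝ) ≤ (tln : ℝ) / (tld : ℝ) := by
    rw [div_le_div_iff₀ hthd' htld']; exact_mod_cast hth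
  have htlo' : (W : ℝ) * ((V : ℝ) + W) * ((tln : ℝ) / (tld : ℝ)) ≤ (U₁ : ℝ) * ((U₁ : ℝ) + V) := by
    have h : (W : ℝ) * ((V : ℝ) + W) * (tln : ℝ) ≤ (U₁ : ℝ) * ((U₁ : ℝ) + V) * (tld : ℝ) := by exact_mod_cast htlo
    rw [← mul_div_assoc, div_le_iff₀ htld']; exact h
  have hclo' : (((V : ℝ) + W) * Real.log ((U₁ : ℝ) + ((V : ℝ) + W) * ((tln : ℝ) / (tld : ℝ)))
        - (W : ℝ) * Real.log (((U₁ : ℝ) + V) + (W : ℝ) * ((tln : ℝ) / (tld : ℝ))) - (V : ℝ) * Real.log ((tln : ℝ) / (tld : ℝ)))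
        - (V : ℝ) * Real.log (V : ℝ) ≤ ℓlo := by
    rw [eAlo, eBlo, etlo]; linarith
  have hchi' : (((V : ℝ) + W) * Real.log ((U₁ : ℝ) + ((V : ℝ) + W) * ((thn : ℝ) / (thd : ℝ)))
        - (W : ℝ) * Real.log (((U₁ : ℝ) + V) + (W : ℝ) * ((thn : ℝ) / (thd : ℝ))) - (V : ℝ) * Real.log ((thn : ℝ) / (thd : ℝ)))
        - (V : ℝ) * Real.log (V : ℝ) ≤ ℓhi := by
    rw [eAhi, eBhi, ethi]; linarith
  have hφ' : φlo ≤ (((U₁ : ℝ) + V) * Real.log (((U₁ : ℝ) + V) + (W : ℝ) * ((tln : ℝ) / (tld : ℝ)))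
        - (U₁ : ℝ) * Real.log ((U₁ : ℝ) + ((V : ℝ) + W) * ((tln : ℝ) / (tld : ℝ)))) - (V : ℝ) * Real.log (V : ℝ) := by
    rw [eAlo, eBlo]; linarith
  have hslope' : (sn : ℝ) / (sd : ℝ) * (ℓhi - ℓlo)
      ≤ ((((U₁ : ℝ) + V) * Real.log (((U₁ : ℝ) + V) + (W : ℝ) * ((thn : ℝ) / (thd : ℝ)))
          - (U₁ : ℝ) * Real.log ((U₁ : ℝ) + ((V : ℝ) + W) * ((thn : ℝ) / (thd : ℝ)))) - (V : ℝ) * Real.log (V : ℝ)) - φlo := by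
    rw [eAhi, eBhi, div_mul_eq_mul_div, div_le_iff₀ hsd']; linarith
  have hσlo' : ℓlo ≤ (((V : ℝ) + W) * Real.log (|c u| * Mu) - (W : ℝ) * Real.log (|c s| * Ms) - (V : ℝ) * Real.log (|c v| * Mv)) := by
    rw [es, eu, ev]; linarith
  have hσhi' : (((V : ℝ) + W) * Real.log (|c u| * Mu) - (W : ℝ) * Real.log (|c s| * Ms) - (V : ℝ) * Real.log (|c v| * Mv)) ≤ ℓhi := by
    rw [es, eu, ev]; linarith
  have key := fourNomial_pocket_secant_lower_of_three_le_countP hU hVp hWp hA hB hC hD h3 hs hthi hth' htlo'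
    hclo' hchi' hφ' hslope' hσlo' hσhi'
  rw [er, es, eu, ev] at key
  have key2 := mul_le_mul_of_nonneg_left key hsd'.le
  rw [mul_sub, mul_sub, ← mul_assoc, ← mul_assoc, mul_div_cancel₀ _ hsd'.ne'] at key2
  linarith

/-- **Secant row on the upper branch, table form** (mirror: `t* ≤ tlo = tln/tld ≤ thi = thn/thd`, slab `ℓlo ≤ σ1 ≤ ℓhi`,
`Λ1(tlo) ≤ ℓlo`, `Λ1(thi) ≤ ℓhi`, `φlo ≤ Λ2(tlo)`, `sn·(ℓhi − ℓlo) ≤ sd·(Λ2(thi) − φlo)`): `sd·φlo − sn·ℓlo ≤ sd·σ2 − sn·σ1`. [folklore] -/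
theorem window_four_pocket_secant_upper_of_table {n : ℕ} {e : ℕ → ℕ} {c : ℕ → ℝ} (he : ∀ i j, i < j → j < n → e i < e j)
    (hZ : n ≤ (∑ t ∈ range n, C (c t) * X ^ (e t) : ℝ[X]).roots.countP (fun x => 0 < x) + 1)
    (E : List ℕ) (hE : ∀ t, t < n → e t = E.getD t 0)
    {r s u v : ℕ} (hrs : r < s) (hsu : s < u) (huv : u < v) (hvn : v < n) (U₁ V W : ℕ)
    (hU₁ : E.getD r 0 + U₁ = E.getD s 0) (hV : E.getD s 0 + V = E.getD u 0) (hW : E.getD u 0 + W = E.getD v 0)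
    (Mr Ms Mu Mv : ℝ)
    (hMr : |∏ w ∈ (range n).filter (fun w => ¬(w = r ∨ w = s ∨ w = u ∨ w = v)), (((E.getD r 0 : ℕ) : ℝ) - (E.getD w 0 : ℕ))| = Mr)
    (hMs : |∏ w ∈ (range n).filter (fun w => ¬(w = r ∨ w = s ∨ w = u ∨ w = v)), (((E.getD s 0 : ℕ) : ℝ) - (E.getD w 0 : ℕ))| = Ms)
    (hMu : |∏ w ∈ (range n).filter (fun w => ¬(w = r ∨ w = s ∨ w = u ∨ w = v)), (((E.getD u 0 : ℕ) : ℝ) - (E.getD w 0 : ℕ))| = Mu)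
    (hMv : |∏ w ∈ (range n).filter (fun w => ¬(w = r ∨ w = s ∨ w = u ∨ w = v)), (((E.getD v 0 : ℕ) : ℝ) - (E.getD w 0 : ℕ))| = Mv)
    (tln tld Alo Blo thn thd Ahi Bhi : ℕ) (htln : 0 < tln) (htld : 0 < tld) (hthn : 0 < thn) (hthd : 0 < thd)
    (hAlo : (U₁ + V) * tld + W * tln = Alo) (hBlo : U₁ * tld + (V + W) * tln = Blo)
    (hAhi : (U₁ + V) * thd + W * thn = Ahi) (hBhi : U₁ * thd + (V + W) * thn = Bhi)
    (hth : tln * thd ≤ thn * tld) (htlo : U₁ * (U₁ + V) * tld ≤ W * (V + W) * tln)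
    (sn sd : ℕ) (hsd : 0 < sd) {ℓlo ℓhi φlo : ℝ}
    (hclo : ((U₁ : ℝ) + V) * Real.log (Alo : ℝ) - (U₁ : ℝ) * Real.log (Blo : ℝ) - (V : ℝ) * Real.log (tld : ℝ) - (V : ℝ) * Real.log (V : ℝ) ≤ ℓlo)
    (hchi : ((U₁ : ℝ) + V) * Real.log (Ahi : ℝ) - (U₁ : ℝ) * Real.log (Bhi : ℝ) - (V : ℝ) * Real.log (thd : ℝ) - (V : ℝ) * Real.log (V : ℝ) ≤ ℓhi)
    (hφ : φlo ≤ ((V : ℝ) + W) * Real.log (Blo : ℝ) - (W : ℝ) * Real.log (Alo : ℝ) - (V : ℝ) * Real.log (tln : ℝ) - (V : ℝ) * Real.log (V : ℝ))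
    (hslope : (sn : ℝ) * (ℓhi - ℓlo)
      ≤ (sd : ℝ) * ((((V : ℝ) + W) * Real.log (Bhi : ℝ) - (W : ℝ) * Real.log (Ahi : ℝ) - (V : ℝ) * Real.log (thn : ℝ)
          - (V : ℝ) * Real.log (V : ℝ)) - φlo))
    (hσlo : ℓlo ≤ ((U₁ : ℝ) + V) * (Real.log |c s| + Real.log Ms) - (V : ℝ) * (Real.log |c r| + Real.log Mr)
        - (U₁ : ℝ) * (Real.log |c u| + Real.log Mu))
    (hσhi : ((U₁ : ℝ) + V) * (Real.log |c s| + Real.log Ms) - (V : ℝ) * (Real.log |c r| + Real.log Mr)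
        - (U₁ : ℝ) * (Real.log |c u| + Real.log Mu) ≤ ℓhi) :
    (sd : ℝ) * φlo - (sn : ℝ) * ℓlo
      ≤ (sd : ℝ) * (((V : ℝ) + W) * (Real.log |c u| + Real.log Mu) - (W : ℝ) * (Real.log |c s| + Real.log Ms)
          - (V : ℝ) * (Real.log |c v| + Real.log Mv))
        - (sn : ℝ) * (((U₁ : ℝ) + V) * (Real.log |c s| + Real.log Ms) - (V : ℝ) * (Real.log |c r| + Real.log Mr)
          - (U₁ : ℝ) * (Real.log |c u| + Real.log Mu)) := by
  obtain ⟨hU, hVp, hWp, ⟨h3, hA, hB, hC, hD⟩, er, es, eu, ev⟩ :=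
    window_four_table_prelims he hZ E hE hrs hsu huv hvn U₁ V W hU₁ hV hW Mr Ms Mu Mv hMr hMs hMu hMv
  have hAlo0 : 0 < Alo := by rw [← hAlo]; positivity
  have hBlo0 : 0 < Blo := by rw [← hBlo]; positivity
  have hAhi0 : 0 < Ahi := by rw [← hAhi]; positivity
  have hBhi0 : 0 < Bhi := by rw [← hBhi]; positivity
  have htld' : (0 : ℝ) < tld := by exact_mod_cast htld
  have hthd' : (0 : ℝ) < thd := by exact_mod_cast hthd
  have htln' : (0 : ℝ) < tln := by exact_mod_cast htln
  have hsd' : (0 : ℝ) < sd := by exact_mod_cast hsd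
  have eAlo : Real.log (((U₁ : ℝ) + V) + (W : ℝ) * ((tln : ℝ) / (tld : ℝ))) = Real.log (Alo : ℝ) - Real.log (tld : ℝ) := by
    have h := log_affine_ratio_of_nat (U₁ + V) W tln tld Alo htld hAlo hAlo0
    push_cast at h; exact h
  have eBlo : Real.log ((U₁ : ℝ) + ((V : ℝ) + W) * ((tln : ℝ) / (tld : ℝ))) = Real.log (Blo : ℝ) - Real.log (tld : ℝ) := by
    have h := log_affine_ratio_of_nat U₁ (V + W) tln tld Blo htld hBlo hBlo0
    push_cast at h; exact h
  have etlo : Real.log ((tln : ℝ) / (tld : ℝ)) = Real.log (tln : ℝ) - Real.log (tld : ℝ) :=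
    Real.log_div htln'.ne' htld'.ne'
  have eAhi : Real.log (((U₁ : ℝ) + V) + (W : ℝ) * ((thn : ℝ) / (thd : ℝ))) = Real.log (Ahi : ℝ) - Real.log (thd : ℝ) := by
    have h := log_affine_ratio_of_nat (U₁ + V) W thn thd Ahi hthd hAhi hAhi0
    push_cast at h; exact h
  have eBhi : Real.log ((U₁ : ℝ) + ((V : ℝ) + W) * ((thn : ℝ) / (thd : ℝ))) = Real.log (Bhi : ℝ) - Real.log (thd : ℝ) := by
    have h := log_affine_ratio_of_nat U₁ (V + W) thn thd Bhi hthd hBhi hBhi0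
    push_cast at h; exact h
  have ethi : Real.log ((thn : ℝ) / (thd : ℝ)) = Real.log (thn : ℝ) - Real.log (thd : ℝ) :=
    Real.log_div (by exact_mod_cast hthn.ne') hthd'.ne'
  have hs : (0 : ℝ) ≤ (sn : ℝ) / (sd : ℝ) := by positivity
  have hth' : (tln : ℝ) / (tld : ℝ) ≤ (thn : ℝ) / (thd : ℝ) := by
    rw [div_le_div_iff₀ htld' hthd']; exact_mod_cast hth
  have htlo' : (U₁ : ℝ) * ((U₁ : ℝ) + V) ≤ (W : ℝ) * ((V : ℝ) + W) * ((tln : ℝ) / (tld : ℝ)) := by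
    have h : (U₁ : ℝ) * ((U₁ : ℝ) + V) * (tld : ℝ) ≤ (W : ℝ) * ((V : ℝ) + W) * (tln : ℝ) := by exact_mod_cast htlo
    rw [← mul_div_assoc, le_div_iff₀ htld']; exact h
  have hclo' : (((U₁ : ℝ) + V) * Real.log (((U₁ : ℝ) + V) + (W : ℝ) * ((tln : ℝ) / (tld : ℝ)))
        - (U₁ : ℝ) * Real.log ((U₁ : ℝ) + ((V : ℝ) + W) * ((tln : ℝ) / (tld : ℝ)))) - (V : ℝ) * Real.log (V : ℝ) ≤ ℓlo := by
    rw [eAlo, eBlo]; linarith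
  have hchi' : (((U₁ : ℝ) + V) * Real.log (((U₁ : ℝ) + V) + (W : ℝ) * ((thn : ℝ) / (thd : ℝ)))
        - (U₁ : ℝ) * Real.log ((U₁ : ℝ) + ((V : ℝ) + W) * ((thn : ℝ) / (thd : ℝ)))) - (V : ℝ) * Real.log (V : ℝ) ≤ ℓhi := by
    rw [eAhi, eBhi]; linarith
  have hφ' : φlo ≤ (((V : ℝ) + W) * Real.log ((U₁ : ℝ) + ((V : ℝ) + W) * ((tln : ℝ) / (tld : ℝ)))
        - (W : ℝ) * Real.log (((U₁ : ℝ) + V) + (W : ℝ) * ((tln : ℝ) / (tld : ℝ))) - (V : ℝ) * Real.log ((tln : ℝ) / (tld : ℝ)))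
        - (V : ℝ) * Real.log (V : ℝ) := by
    rw [eAlo, eBlo, etlo]; linarith
  have hslope' : (sn : ℝ) / (sd : ℝ) * (ℓhi - ℓlo)
      ≤ ((((V : ℝ) + W) * Real.log ((U₁ : ℝ) + ((V : ℝ) + W) * ((thn : ℝ) / (thd : ℝ)))
          - (W : ℝ) * Real.log (((U₁ : ℝ) + V) + (W : ℝ) * ((thn : ℝ) / (thd : ℝ))) - (V : ℝ) * Real.log ((thn : ℝ) / (thd : ℝ)))
          - (V : ℝ) * Real.log (V : ℝ)) - φlo := by
    rw [eAhi, eBhi, ethi, div_mul_eq_mul_div, div_le_iff₀ hsd']; linarith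
  have hσlo' : ℓlo ≤ (((U₁ : ℝ) + V) * Real.log (|c s| * Ms) - (V : ℝ) * Real.log (|c r| * Mr) - (U₁ : ℝ) * Real.log (|c u| * Mu)) := by
    rw [er, es, eu]; linarith
  have hσhi' : (((U₁ : ℝ) + V) * Real.log (|c s| * Ms) - (V : ℝ) * Real.log (|c r| * Mr) - (U₁ : ℝ) * Real.log (|c u| * Mu)) ≤ ℓhi := by
    rw [er, es, eu]; linarith
  have key := fourNomial_pocket_secant_upper_of_three_le_countP hU hVp hWp hA hB hC hD h3 hs htlo' hth'
    hclo' hchi' hφ' hslope' hσlo' hσhi'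
  rw [er, es, eu, ev] at key
  have key2 := mul_le_mul_of_nonneg_left key hsd'.le
  rw [mul_sub, mul_sub, ← mul_assoc, ← mul_assoc, mul_div_cancel₀ _ hsd'.ne'] at key2
  linarith

end Summit.ValiantsHypothesis.ValiantsHypothesis.Theorems.LacunarySymmetroidMatrixDescartes.Census
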